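import Mathlib
import Literature.Computability.AlgebraicComplexity.GroupTheoreticMatMul
import Literature.Barriers.MatrixMultiplication.TricoloredSumFreeBarrier
import Summits.MatrixMultiplication.MatrixMultiplication.Theorems.GroupTheoreticSTPPCThesisPackingSumset
import Summits.MatrixMultiplication.MatrixMultiplication.Theorems.AbelianSTPPCensusIteratedRoom
import Summits.MatrixMultiplication.MatrixMultiplication.Theorems.AbelianSTPPCensusThreeRoomEnergy

/-!
# The three-room energy rule, room-cardinality form (cell mm-stpp, eng-2 g4)

`STPPThreeRoomEnergy.three_room_energy` (rule E3) bounds the three U14⁺ SLACKS of a member of an STPP family.  The same argument with the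
member's three ACTUAL room cardinalities `R_C ≥ |(A_t−B_t)+(C_t−C_t)|`, `R_A ≥ |(B_t−C_t)+(A_t−A_t)|`, `R_B ≥ |(C_t−A_t)+(B_t−B_t)|`
gives **`|G|·(4V − (R_A+R_B+R_C)) ≤ V²`** whenever `2V > |G|` (`energy_rooms`) — a necessary condition on ONE TPP triple (take `N = 1`), usable
as a search constraint for existence attempts (SAT/ILS lanes): e.g. every `(6,6,6)` TPP triple in an abelian group of order 338 has room sum
`≥ 726` (`room_sum_ge_726_of_666_at_338`), while the list `(7,5,5)+(6,6,6)³` would need `≤ 703` (mm-stpp-eng-1 g4's annealing minima: 804/806).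
Ingredients: `two_mul_card_le_overlap_add_card_sub` (two translates of `W` inside `W − C`, isolated from theory g8's `room_popular`),
the sign transfer `STPPThreeRoomEnergy.overlap_rotate_eq`, `STPPIteratedRoom.overlap_add`, `card_mul_le_card_sq`.
WHAT THIS IS NOT: no `ω` statement, no census row, no construction.
-/

-- single-conjunct summit: the mandated namespace repeats `MatrixMultiplication`.
set_option linter.dupNamespace false

namespace Summit.MatrixMultiplication.MatrixMultiplication.Theorems

namespace STPPThreeRoomEnergy

open Finset Literature.Computability.AlgebraicComplexity
open scoped Pointwise

variable {G : Type*} [AddCommGroup G] [DecidableEq G]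

/-- Two translates of `W` inside `W − C`: for `c, c' ∈ C`, `2|W| ≤ |W ∩ (W + (c − c'))| + |W − C|` (any finsets; the heart of
`STPPIteratedRoom.room_popular`, isolated). [folklore] -/
theorem two_mul_card_le_overlap_add_card_sub (W C : Finset G) {c c' : G} (hc : c ∈ C) (hc' : c' ∈ C) :
    2 * W.card ≤ (W.filter (· - (c - c') ∈ W)).card + (W - C).card := by
  classical
  set X : Finset G := W.image (· - c') with hX
  set Y : Finset G := W.image (· - c) with hY
  have hXc : X.card = W.card := card_image_of_injective _ (sub_left_injective)
  have hYc : Y.card = W.card := card_image_of_injective _ (sub_left_injective)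
  have hXs : X ⊆ W - C := by
    intro x hx; rw [hX, mem_image] at hx; obtain ⟨w, hw, rfl⟩ := hx; exact sub_mem_sub hw hc'
  have hYs : Y ⊆ W - C := by
    intro x hx; rw [hY, mem_image] at hx; obtain ⟨w, hw, rfl⟩ := hx; exact sub_mem_sub hw hc
  have hXY : (X ∩ Y).card ≤ (W.filter (· - (c - c') ∈ W)).card := by
    refine card_le_card_of_injOn (· + c) ?_ (fun x _ y _ hxy => by simpa using hxy)
    intro x hx
    rw [mem_coe, mem_inter, hX, hY, mem_image, mem_image] at hx
    obtain ⟨⟨w, hw, rfl⟩, w', hw', he⟩ := hx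
    rw [mem_coe, mem_filter]
    refine ⟨?_, ?_⟩
    · show w - c' + c ∈ W
      have : w - c' + c = w' := by rw [← he]; abel
      rw [this]; exact hw'
    · show w - c' + c - (c - c') ∈ W
      have : w - c' + c - (c - c') = w := by abel
      rw [this]; exact hw
  have h1 : (X ∪ Y).card ≤ (W - C).card := card_le_card (union_subset hXs hYs)
  have h2 := card_union_add_card_inter X Y
  omega

variable [Fintype G] {N : ℕ} {A B C : Fin N → Finset G}

/-- **E3, room-cardinality form (one member, its three ACTUAL rooms).**  For a member `t` of an `IsSTPP` family (any `N`, e.g. `N = 1`: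
a single TPP triple) with all `A_u`, `B_u` non-empty, `V = |A_t||B_t||C_t| > |G|/2`, and bounds `R_C ≥ |(A_t−B_t)+(C_t−C_t)|`,
`R_A ≥ |(B_t−C_t)+(A_t−A_t)|`, `R_B ≥ |(C_t−A_t)+(B_t−B_t)|`: **`|G| · (4V − (R_A + R_B + R_C)) ≤ V²`** (truncated).  With the U14⁺ caps as
the `R`'s this is `three_room_energy`. [original] -/
theorem energy_rooms (h : IsSTPP A B C) (hA : ∀ u, (A u).Nonempty) (hB : ∀ u, (B u).Nonempty)
    (t : Fin N) (RA RB RC : ℕ)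
    (hRC : ((A t - B t) + (C t - C t)).card ≤ RC) (hRA : ((B t - C t) + (A t - A t)).card ≤ RA)
    (hRB : ((C t - A t) + (B t - B t)).card ≤ RB)
    (hbig : Fintype.card G < 2 * ((A t).card * (B t).card * (C t).card)) :
    Fintype.card G * (4 * ((A t).card * (B t).card * (C t).card) - (RA + RB + RC)) ≤
      ((A t).card * (B t).card * (C t).card) ^ 2 := by
  classical
  have hV : (A t - B t + C t).card = (A t).card * (B t).card * (C t).card := STPPIteratedRoom.card_sub_add_eq h t
  have hV' : (B t - C t + A t).card = (A t).card * (B t).card * (C t).card := by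
    rw [STPPIteratedRoom.card_sub_add_eq h.rotate t]; ring
  have hV'' : (C t - A t + B t).card = (A t).card * (B t).card * (C t).card := by
    rw [STPPIteratedRoom.card_sub_add_eq h.rotate.rotate t]; ring
  -- the three room sets as `W − X`
  have eC : (A t - B t + C t) - C t = (A t - B t) + (C t - C t) := by
    rw [sub_eq_add_neg (A t - B t + C t), add_assoc, ← sub_eq_add_neg (C t)]
  have eA : (B t - C t + A t) - A t = (B t - C t) + (A t - A t) := by
    rw [sub_eq_add_neg (B t - C t + A t), add_assoc, ← sub_eq_add_neg (A t)]
  have eB : (C t - A t + B t) - B t = (C t - A t) + (B t - B t) := by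
    rw [sub_eq_add_neg (C t - A t + B t), add_assoc, ← sub_eq_add_neg (B t)]
  -- popularity of each difference class for the one set `W = A_t − B_t + C_t`
  have pC : ∀ d ∈ C t - C t, 2 * ((A t).card * (B t).card * (C t).card) ≤
      ((A t - B t + C t).filter (· - d ∈ A t - B t + C t)).card + RC := by
    intro d hd
    obtain ⟨c, hc, c', hc', rfl⟩ := mem_sub.1 hd
    have := two_mul_card_le_overlap_add_card_sub (A t - B t + C t) (C t) hc hc'
    rw [eC, hV] at this; omega
  have pA : ∀ d ∈ A t - A t, 2 * ((A t).card * (B t).card * (C t).card) ≤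
      ((A t - B t + C t).filter (· - d ∈ A t - B t + C t)).card + RA := by
    intro d hd
    obtain ⟨a, ha, a', ha', rfl⟩ := mem_sub.1 hd
    have := two_mul_card_le_overlap_add_card_sub (B t - C t + A t) (A t) ha ha'
    rw [eA, hV', overlap_rotate_eq h hA t] at this; omega
  have pB : ∀ d ∈ B t - B t, 2 * ((A t).card * (B t).card * (C t).card) ≤
      ((A t - B t + C t).filter (· - d ∈ A t - B t + C t)).card + RB := by
    intro d hd
    obtain ⟨b, hb, b', hb', rfl⟩ := mem_sub.1 hd
    have := two_mul_card_le_overlap_add_card_sub (C t - A t + B t) (B t) hb hb'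
    rw [eB, hV'', overlap_rotate_eq h.rotate hB t, overlap_rotate_eq h hA t] at this; omega
  -- every `g` is popular
  have pall : ∀ g : G, 4 * ((A t).card * (B t).card * (C t).card) ≤
      ((A t - B t + C t).filter (· - g ∈ A t - B t + C t)).card + (RA + RB + RC) := by
    intro g
    obtain ⟨w, hw, hwg⟩ : ∃ w ∈ A t - B t + C t, w - g ∈ A t - B t + C t := by
      by_contra hcon
      push Not at hcon
      have hdisj : Disjoint (A t - B t + C t) ((A t - B t + C t).image (· + g)) := by
        rw [disjoint_left]
        intro w hw hw'
        rw [mem_image] at hw'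
        obtain ⟨w', hw', rfl⟩ := hw'
        exact hcon _ hw (by rwa [add_sub_cancel_right])
      have h1 := card_le_univ ((A t - B t + C t) ∪ (A t - B t + C t).image (· + g))
      rw [card_union_of_disjoint hdisj, card_image_of_injective _ (add_left_injective g)] at h1
      omega
    obtain ⟨x, hx, c, hc, rfl⟩ := mem_add.1 hw
    obtain ⟨a, ha, b, hb, rfl⟩ := mem_sub.1 hx
    obtain ⟨x', hx', c', hc', he⟩ := mem_add.1 hwg
    obtain ⟨a', ha', b', hb', rfl⟩ := mem_sub.1 hx'
    have hg : g = (a - a') + ((b' - b) + (c - c')) := by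
      have : g = (a - b + c) - (a' - b' + c') := by rw [he]; abel
      rw [this]; abel
    have h1 := pA (a - a') (sub_mem_sub ha ha')
    have h2 := pB (b' - b) (sub_mem_sub hb' hb)
    have h3 := pC (c - c') (sub_mem_sub hc hc')
    have h4 := STPPIteratedRoom.overlap_add (A t - B t + C t) (b' - b) (c - c')
    have h5 := STPPIteratedRoom.overlap_add (A t - B t + C t) (a - a') ((b' - b) + (c - c'))
    rw [hV] at h4 h5
    rw [hg]
    omega
  have := STPPIteratedRoom.card_mul_le_card_sq (A t - B t + C t) univ
    (4 * ((A t).card * (B t).card * (C t).card) - (RA + RB + RC)) (fun g _ => by have := pall g; omega)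
  rwa [card_univ, hV] at this

/-- **Every `(6,6,6)` TPP triple in an abelian group of order 338 has room sum at least `726`** (`338 · (864 − ΣR) ≤ 46656` forces
`ΣR ≥ 726`; the list `(7,5,5)+(6,6,6)³` would need `ΣR ≤ 703` — mm-stpp-eng-1 g4 conjectured `≥ 704` from annealing minima `804/806`).
Stated for a member of any `IsSTPP` family (take `N = 1` for a lone triple). [original] -/
theorem room_sum_ge_726_of_666_at_338 (h : IsSTPP A B C) (hA : ∀ u, (A u).Nonempty) (hB : ∀ u, (B u).Nonempty)
    (t : Fin N) (ha : (A t).card = 6) (hb : (B t).card = 6) (hc : (C t).card = 6)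
    (hM : Fintype.card G = 338) :
    726 ≤ ((B t - C t) + (A t - A t)).card + ((C t - A t) + (B t - B t)).card + ((A t - B t) + (C t - C t)).card := by
  have := energy_rooms h hA hB t _ _ _ le_rfl le_rfl le_rfl (by rw [ha, hb, hc, hM]; norm_num)
  rw [ha, hb, hc, hM] at this
  omega

end STPPThreeRoomEnergy

end Summit.MatrixMultiplication.MatrixMultiplication.Theorems
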